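import Mathlib

/-!
# Route `UniversalDetector` / `FixedTorusFirst`, LINES g11-1 «blind detector» / g11-2 «engine tori» — null hyperplanes

Planner ym-idea-8 g11; shared analysis stub `BlindDetectorRigidity` of the supports `UniversalDetector.BlindDetector`
(stmt-QuantumFields-24148) and `FixedTorusFirst.SomeTorusDetector` (stmt-QuantumFields-24177).  The blind detector runs
on the open set `Ω = {z ∈ ℝ⁴ : z_i ≠ 0 ∀ i}`; the only measure theory it needs beyond the landed `DetectorRigidity` chain
is that the coordinate hyperplanes are Lebesgue-null, so that «for almost every point, all coordinates (of a difference)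
are non-zero» — which turns the pointwise-continuity bullets of the two dominated-convergence arguments of the landed chain
(`sliceIdentity`, `gaussDeconv`) into almost-everywhere bullets.  Mathlib only:
`Measure.addHaar_submodule` (proper subspaces are Haar-null) and translation invariance.

Contents (def-free): `isOpen_allCoords_ne_zero` (Ω is open) · `volume_coordHyperplane_eq_zero` (`{x : x_i = c}` is null in
`ℝᵈ`) · `ae_forall_apply_ne` / `ae_forall_sub_apply_ne_zero` (a.e. `x`, all `x_i ≠ y_i`) · `volume_prod_diffHyperplane_eq_zero`
and `ae_forall_sub_apply_ne_zero_prod` (a.e. `(v, w) ∈ ℝᵈ × ℝᵈ`, all `(w − v)_i ≠ 0`).  No summit, rung or crux is proved.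
[folklore]
-/

set_option autoImplicit false

noncomputable section

open MeasureTheory Set

namespace Summit.QuantumFields.YangMills.Cruxes.BlindDetectorRigidity

variable {d : ℕ}

/-- The coordinate functionals of `ℝᵈ` are continuous. -/
theorem continuous_coord (i : Fin d) : Continuous fun z : EuclideanSpace ℝ (Fin d) => z i :=
  (EuclideanSpace.proj i : EuclideanSpace ℝ (Fin d) →L[ℝ] ℝ).continuous

/-- `Ω = {z : all coordinates non-zero}` is open. [folklore] -/
theorem isOpen_allCoords_ne_zero : IsOpen {z : EuclideanSpace ℝ (Fin d) | ∀ i, z i ≠ 0} := by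
  rw [show {z : EuclideanSpace ℝ (Fin d) | ∀ i, z i ≠ 0} = ⋂ i, {z | z i ≠ 0} by ext z; simp]
  exact isOpen_iInter_of_finite fun i => isOpen_ne_fun (continuous_coord i) continuous_const

/-- **Coordinate hyperplanes are Lebesgue-null in `ℝᵈ`** (the hyperplane through the origin is a proper subspace,
hence Haar-null; translate). [folklore] -/
theorem volume_coordHyperplane_eq_zero (i : Fin d) (c : ℝ) :
    volume {x : EuclideanSpace ℝ (Fin d) | x i = c} = 0 := by
  -- the coordinate hyperplane through the origin
  let L : Submodule ℝ (EuclideanSpace ℝ (Fin d)) :=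
    LinearMap.ker (EuclideanSpace.proj i : EuclideanSpace ℝ (Fin d) →L[ℝ] ℝ).toLinearMap
  have hmem : ∀ z : EuclideanSpace ℝ (Fin d), z ∈ L ↔ z i = 0 := fun z => by simp [L]
  have hL : L ≠ ⊤ := by
    intro h
    have h1 : WithLp.toLp 2 (Pi.single i (1 : ℝ)) ∈ L := by rw [h]; exact Submodule.mem_top
    rw [hmem, PiLp.toLp_apply, Pi.single_eq_same] at h1
    exact one_ne_zero h1
  have h0 : volume (L : Set (EuclideanSpace ℝ (Fin d))) = 0 := Measure.addHaar_submodule volume L hL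
  have hset : {x : EuclideanSpace ℝ (Fin d) | x i = c} =
      (fun x => x + WithLp.toLp 2 (Pi.single i (-c))) ⁻¹' (L : Set (EuclideanSpace ℝ (Fin d))) := by
    ext x
    simp only [mem_setOf_eq, mem_preimage, SetLike.mem_coe, hmem, PiLp.add_apply, Pi.single_eq_same]
    constructor
    · intro h; rw [h]; ring
    · intro h; linarith
  rw [hset, measure_preimage_add_right]
  exact h0

/-- **Almost every point of `ℝᵈ` has all coordinates different from those of a fixed point.** [folklore] -/
theorem ae_forall_apply_ne (y : EuclideanSpace ℝ (Fin d)) :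
    ∀ᵐ x : EuclideanSpace ℝ (Fin d) ∂volume, ∀ i, x i ≠ y i := by
  rw [ae_all_iff]
  intro i
  rw [ae_iff]
  have : {x : EuclideanSpace ℝ (Fin d) | ¬x i ≠ y i} = {x | x i = y i} := by ext x; simp
  rw [this]
  exact volume_coordHyperplane_eq_zero i (y i)

/-- Almost every `x ∈ ℝᵈ` has `(y − x)_i ≠ 0` for all `i`. [folklore] -/
theorem ae_forall_sub_apply_ne_zero (y : EuclideanSpace ℝ (Fin d)) :
    ∀ᵐ x : EuclideanSpace ℝ (Fin d) ∂volume, ∀ i, (y - x) i ≠ 0 := by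
  filter_upwards [ae_forall_apply_ne y] with x hx i
  rw [PiLp.sub_apply]
  exact fun h => hx i (by linarith)

/-- **Difference hyperplanes `{(v, w) : (w − v)_i = 0}` are null in `ℝᵈ × ℝᵈ`** (a proper subspace of the product,
Haar-null for the product of the Lebesgue measures). [folklore] -/
theorem volume_prod_diffHyperplane_eq_zero (i : Fin d) :
    ((volume : Measure (EuclideanSpace ℝ (Fin d))).prod volume)
      {q : EuclideanSpace ℝ (Fin d) × EuclideanSpace ℝ (Fin d) | (q.2 - q.1) i = 0} = 0 := by
  let L : Submodule ℝ (EuclideanSpace ℝ (Fin d) × EuclideanSpace ℝ (Fin d)) :=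
    LinearMap.ker
      (((EuclideanSpace.proj i : EuclideanSpace ℝ (Fin d) →L[ℝ] ℝ).toLinearMap.comp
          (LinearMap.snd ℝ (EuclideanSpace ℝ (Fin d)) (EuclideanSpace ℝ (Fin d)))) -
        ((EuclideanSpace.proj i : EuclideanSpace ℝ (Fin d) →L[ℝ] ℝ).toLinearMap.comp
          (LinearMap.fst ℝ (EuclideanSpace ℝ (Fin d)) (EuclideanSpace ℝ (Fin d)))))
  have hmem : ∀ q : EuclideanSpace ℝ (Fin d) × EuclideanSpace ℝ (Fin d), q ∈ L ↔ (q.2 - q.1) i = 0 := fun q => by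
    simp [L]
  have hL : L ≠ ⊤ := by
    intro h
    have h1 : ((0 : EuclideanSpace ℝ (Fin d)), WithLp.toLp 2 (Pi.single i (1 : ℝ))) ∈ L := by
      rw [h]; exact Submodule.mem_top
    rw [hmem] at h1
    simp at h1
  have hset : {q : EuclideanSpace ℝ (Fin d) × EuclideanSpace ℝ (Fin d) | (q.2 - q.1) i = 0} =
      (L : Set (EuclideanSpace ℝ (Fin d) × EuclideanSpace ℝ (Fin d))) := by
    ext q; rw [mem_setOf_eq, SetLike.mem_coe, hmem]
  rw [hset]
  exact Measure.addHaar_submodule _ L hL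

/-- **Almost every pair `(v, w) ∈ ℝᵈ × ℝᵈ` has `(w − v)_i ≠ 0` for all `i`.** [folklore] -/
theorem ae_forall_sub_apply_ne_zero_prod :
    ∀ᵐ q : EuclideanSpace ℝ (Fin d) × EuclideanSpace ℝ (Fin d)
      ∂((volume : Measure (EuclideanSpace ℝ (Fin d))).prod volume), ∀ i, (q.2 - q.1) i ≠ 0 := by
  rw [ae_all_iff]
  intro i
  rw [ae_iff]
  have : {q : EuclideanSpace ℝ (Fin d) × EuclideanSpace ℝ (Fin d) | ¬(q.2 - q.1) i ≠ 0} =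
      {q | (q.2 - q.1) i = 0} := by ext q; simp
  rw [this]
  exact volume_prod_diffHyperplane_eq_zero i

end Summit.QuantumFields.YangMills.Cruxes.BlindDetectorRigidity

end
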